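import Summits.Ventures.Crystal3D.Bulk.GapOrientation
import HarnessLib

/-!
# The oriented successor is THE counter-clockwise next tight arc: no tight partner lies strictly
# inside the sector from `j` to `onextNbr c i j` (`phase2/LEAN-FACES-DESIGN.md` §5.2)

HONEST FRAMING. Part of the venture `Summits/Ventures/Crystal3D` (cell `pub-crystal3d`, phase 2;
seat typer-bulk-2). `Bulk/GapOrientation.lean` defines the oriented rotation `onextNbr` of the
two-level tight map and proves `IsGapConfig.orient3_onextNbr_pos`: the successor of the arc
`i → j` lies on the positive side of the plane through `gapDir c i`, `gapDir c j` (gap `< π`).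
THIS file adds the complementary MINIMALITY statement that pins the successor down geometrically,
free of tangent frames: **`IsGapConfig.not_partner_in_sector`** — for a gap `< π`, no other tight
partner `l` of `i` satisfies both `orient3 (u_i) (u_j) (u_l) > 0` and
`orient3 (u_i) (u_l) (u_{onextNbr c i j}) > 0`, i.e. none lies strictly inside the (convex)
sector swept counter-clockwise from the arc towards `j` to the arc towards the successor. With
`orient3_onextNbr_pos` this characterises `onextNbr c i j` as the angularly next tight arc
counter-clockwise (seen from outside) — the rotation system of the DRAWN tight graph that a
plane-map enumeration means. Tools: `sin_pos_cases` (where `sin > 0` on `(−2π, 2π)`),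
`not_sin_pos_between` (azimuth bookkeeping on `(−π, π]`).

Nothing is claimed about GAP(1.26).
-/

noncomputable section

open scoped BigOperators InnerProductSpace RealInnerProductSpace
open Finset Real

namespace Summit.Ventures.Crystal3D

open Literature.Geometry.DiscreteGeometry

variable {c : Fin 14 → EuclideanSpace ℝ (Fin 3)}

/-- Where the sine is positive on `(−2π, 2π)`: in `(0, π)` or in `(−2π, −π)`. -/
theorem sin_pos_cases {x : ℝ} (h1 : -(2 * π) < x) (h2 : x < 2 * π) (h : 0 < Real.sin x) :
    (0 < x ∧ x < π) ∨ x < -π := by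
  by_cases hx : 0 ≤ x
  · left
    refine ⟨lt_of_le_of_ne hx ?_, ?_⟩
    · rintro rfl
      rw [Real.sin_zero] at h
      exact lt_irrefl 0 h
    · by_contra hge
      push Not at hge
      have e : Real.sin x = Real.sin (x - 2 * π) := (Real.sin_sub_two_pi x).symm
      rw [e] at h
      have := Real.sin_nonpos_of_nonpos_of_neg_pi_le (by linarith) (by linarith) (x := x - 2 * π)
      linarith
  · right
    push Not at hx
    by_contra hge
    push Not at hge
    have := Real.sin_nonpos_of_nonpos_of_neg_pi_le hx.le hge
    linarith

/-- **Azimuth bookkeeping.** For the sorted azimuths `e` of the tight partners of a ball (values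
in `(−π, π]`, strictly increasing in the position), a position `p` whose gap to the next position
is `< π`, and a third position `m' ∉ {p, p⁺}`: it is impossible that both
`sin (e m' − e p) > 0` and `sin (e p⁺ − e m') > 0`. -/
theorem not_sin_pos_between (c : Fin 14 → EuclideanSpace ℝ (Fin 3)) (i : Fin 14) {k : ℕ}
    (hd : (tightAngles c i).card = k + 1) (p m' : Fin (k + 1)) (hm'p : m' ≠ p)
    (hm'r : m' ≠ finRotate (k + 1) p) (hgap : tightGap c i hd p < π) :
    ¬ (0 < Real.sin (sortedTightAngle c i hd m' - sortedTightAngle c i hd p) ∧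
        0 < Real.sin (sortedTightAngle c i hd (finRotate (k + 1) p) - sortedTightAngle c i hd m')) := by
  rintro ⟨h1, h2⟩
  have hmono := (sortedTightAngle c i hd).strictMono
  set e := sortedTightAngle c i hd with he
  have bp := sortedTightAngle_mem c i hd p
  have bm := sortedTightAngle_mem c i hd m'
  have br := sortedTightAngle_mem c i hd (finRotate (k + 1) p)
  have c1 := sin_pos_cases (by linarith [bp.2, bm.1]) (by linarith [bp.1, bm.2]) h1
  have c2 := sin_pos_cases (by linarith [br.1, bm.2]) (by linarith [br.2, bm.1]) h2
  unfold tightGap at hgap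
  by_cases hp : p = Fin.last k
  · -- wrap-around gap: `e 0 − e last + 2π < π`, and `m'` is strictly between `0` and `last`
    subst hp
    rw [finRotate_last, if_pos rfl] at hgap
    rw [finRotate_last] at hm'r c2 br
    have hlt1 : e m' < e (Fin.last k) := hmono (lt_of_le_of_ne (Fin.le_last m') hm'p)
    have hlt2 : e 0 < e m' := hmono (lt_of_le_of_ne (Fin.zero_le _) (Ne.symm hm'r))
    rcases c1 with ⟨c1a, -⟩ | c1b
    · linarith
    rcases c2 with ⟨c2a, -⟩ | c2b
    · linarith
    linarith [bp.2, br.1]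
  · rw [if_neg hp, add_zero, finRotate_apply] at hgap
    rw [finRotate_apply] at hm'r c2 br
    have hlt : p < Fin.last k := lt_of_le_of_ne (Fin.le_last p) hp
    have hpp : p < p + 1 := Fin.lt_add_one_iff.2 hlt
    have hab : e p < e (p + 1) := hmono hpp
    -- `m' < p` or `p + 1 < m'`
    rcases lt_or_gt_of_ne hm'p with hlt' | hgt'
    · have hxa : e m' < e p := hmono hlt'
      rcases c1 with ⟨c1a, -⟩ | c1b
      · linarith
      rcases c2 with ⟨-, c2a⟩ | c2b
      · linarith
      · linarith
    · have hgt'' : p + 1 < m' := by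
        rcases lt_or_gt_of_ne hm'r with h | h
        · exfalso
          -- `p < m' < p + 1` is impossible in `Fin`
          have h3 : (m' : ℕ) < (p + 1 : Fin (k + 1)) := h
          rw [Fin.val_add_one_of_lt hlt] at h3
          have h4 : (p : ℕ) < m' := hgt'
          omega
        · exact h
      have hxb : e (p + 1) < e m' := hmono hgt''
      rcases c2 with ⟨c2a, -⟩ | c2b
      · linarith
      rcases c1 with ⟨-, c1a⟩ | c1b
      · linarith
      · linarith

/-- A positive product `r · r' · s · 1` with `r, r' > 0` has `s > 0`. -/
theorem pos_of_mul_mul_pos {r r' s : ℝ} (hr : 0 < r) (hr' : 0 < r') (h : 0 < r * r' * s) : 0 < s := by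
  by_contra hs
  push Not at hs
  have := mul_nonpos_of_nonneg_of_nonpos (mul_pos hr hr').le hs
  linarith

/-- **No tight partner strictly inside the sector from `j` to its oriented successor.** For an
admissible configuration with `intruderDist² < 3`, a ball `i ≠ 0`, a tight partner `j` whose
oriented gap is `< π`, and any other tight partner `l ∉ {j, onextNbr c i j}`: NOT both
`orient3 (u_i) (u_j) (u_l) > 0` and `orient3 (u_i) (u_l) (u_{onextNbr c i j}) > 0`
(`u = gapDir c`). Together with `IsGapConfig.orient3_onextNbr_pos` (the successor itself IS on
the positive side of `u_i, u_j`): the successor is the angularly next tight arc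
counter-clockwise, a frame-free characterisation of the rotation system `onextNbr`. -/
theorem IsGapConfig.not_partner_in_sector (hc : IsGapConfig c) (hD3 : intruderDist c ^ 2 < 3)
    {i j l : Fin 14} (hi0 : i ≠ 0) (hj : j ∈ tightNbrs c i) (hl : l ∈ tightNbrs c i) (hlj : l ≠ j)
    (hln : l ≠ onextNbr c i j) (hlt : odartGap c i j < π) :
    ¬ (0 < orient3 (gapDir c i) (gapDir c j) (gapDir c l) ∧
        0 < orient3 (gapDir c i) (gapDir c l) (gapDir c (onextNbr c i j))) := by
  have hD1 := hc.one_le_intruderDist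
  have hD2 : intruderDist c < 2 := by nlinarith
  obtain ⟨k, hd⟩ := hc.exists_card_tightAngles_eq_succ hD3 hi0 ⟨j, hj⟩
  obtain ⟨m, rfl⟩ := hc.exists_tightNbrAt_eq hD3 hi0 hd hj
  obtain ⟨m', rfl⟩ := hc.exists_tightNbrAt_eq hD3 hi0 hd hl
  have hj0 := (mem_tightNbrs.1 hj).1
  have hl0 := (mem_tightNbrs.1 hl).1
  have rj := hc.trad_pos hD2 hi0 hj
  have rl := hc.trad_pos hD2 hi0 hl
  have hmm' : m' ≠ m := fun h => hlj (by rw [h])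
  rintro ⟨h1, h2⟩
  unfold odartGap onextNbr at *
  split_ifs at hlt hln h2 with h
  · -- right-handed frame
    rw [nextNbr_tightNbrAt hd m] at hln h2
    rw [dartGap_tightNbrAt hd m] at hlt
    have hn := tightNbrAt_mem c i hd (finRotate (k + 1) m)
    have rn := hc.trad_pos hD2 hi0 hn
    have hm'r : m' ≠ finRotate (k + 1) m := fun h' => hln (by rw [h'])
    rw [hc.orient3_gapDir hi0 hj0 hl0, h, mul_one, tightAzimuth_tightNbrAt,
      tightAzimuth_tightNbrAt] at h1
    rw [hc.orient3_gapDir hi0 hl0 (mem_tightNbrs.1 hn).1, h, mul_one, tightAzimuth_tightNbrAt,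
      tightAzimuth_tightNbrAt] at h2
    exact not_sin_pos_between c i hd m m' hmm' hm'r hlt
      ⟨pos_of_mul_mul_pos rj rl h1, pos_of_mul_mul_pos rl rn h2⟩
  · -- left-handed frame: the successor is at the previous position `p`, `rot p = m`
    have h' : frameDet c i = -1 := frameDet_eq_neg_one_of_ne h
    rw [prevNbr_tightNbrAt hd m] at hln h2 hlt
    set p := (finRotate (k + 1)).symm m with hp
    have hpm : finRotate (k + 1) p = m := Equiv.apply_symm_apply _ _
    rw [dartGap_tightNbrAt hd p] at hlt
    have hn := tightNbrAt_mem c i hd p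
    have rn := hc.trad_pos hD2 hi0 hn
    have hm'p : m' ≠ p := fun h'' => hln (by rw [h''])
    have hm'r : m' ≠ finRotate (k + 1) p := by rw [hpm]; exact hmm'
    rw [hc.orient3_gapDir hi0 hj0 hl0, h', tightAzimuth_tightNbrAt, tightAzimuth_tightNbrAt] at h1
    rw [hc.orient3_gapDir hi0 hl0 (mem_tightNbrs.1 hn).1, h', tightAzimuth_tightNbrAt,
      tightAzimuth_tightNbrAt] at h2
    -- `r r' sin(x) (−1) > 0` gives `sin (−x) > 0`
    have h1' : 0 < Real.sin (sortedTightAngle c i hd (finRotate (k + 1) p) -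
        sortedTightAngle c i hd m') := by
      rw [hpm]
      have e1 : trad (gapDir c i) (gapDir c (tightNbrAt c i hd m)) *
          trad (gapDir c i) (gapDir c (tightNbrAt c i hd m')) *
          Real.sin (sortedTightAngle c i hd m' - sortedTightAngle c i hd m) * -1 =
          trad (gapDir c i) (gapDir c (tightNbrAt c i hd m)) *
          trad (gapDir c i) (gapDir c (tightNbrAt c i hd m')) *
          Real.sin (sortedTightAngle c i hd m - sortedTightAngle c i hd m') := by
        rw [show sortedTightAngle c i hd m - sortedTightAngle c i hd m' =
          -(sortedTightAngle c i hd m' - sortedTightAngle c i hd m) by ring, Real.sin_neg]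
        ring
      rw [e1] at h1
      exact pos_of_mul_mul_pos rj rl h1
    have h2' : 0 < Real.sin (sortedTightAngle c i hd m' - sortedTightAngle c i hd p) := by
      have e2 : trad (gapDir c i) (gapDir c (tightNbrAt c i hd m')) *
          trad (gapDir c i) (gapDir c (tightNbrAt c i hd p)) *
          Real.sin (sortedTightAngle c i hd p - sortedTightAngle c i hd m') * -1 =
          trad (gapDir c i) (gapDir c (tightNbrAt c i hd m')) *
          trad (gapDir c i) (gapDir c (tightNbrAt c i hd p)) *
          Real.sin (sortedTightAngle c i hd m' - sortedTightAngle c i hd p) := by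
        rw [show sortedTightAngle c i hd m' - sortedTightAngle c i hd p =
          -(sortedTightAngle c i hd p - sortedTightAngle c i hd m') by ring, Real.sin_neg]
        ring
      rw [e2] at h2
      exact pos_of_mul_mul_pos rl rn h2
    exact not_sin_pos_between c i hd p m' hm'p hm'r hlt ⟨h2', h1'⟩

end Summit.Ventures.Crystal3D
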